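import Summits.BirchSwinnertonDyer.BirchSwinnertonDyer.Theses.ResidualThetaTransportAtTwo
import Summits.BirchSwinnertonDyer.BirchSwinnertonDyer.Theorems.UniversalToricDescentLocalH1Corank
import Summits.BirchSwinnertonDyer.BirchSwinnertonDyer.Theorems.ResidualThetaTransportAtTwoResidualSignedLambdaLowerCMAtTwoCofreeTorsionFinite
import HarnessLib

/-!
# Sketch (stub-ideation k1 g11) — `stub_cmLambdaLower`: the S₀-block DICHOTOMY `D_w ∈ {0, A_ρ}`
# (weakest sufficient S₀-bookkeeping / strongest provable local structure at `w ∤ 2`)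

Typed sketch for the idea card `stub-cmlambdalower-k1-g11` (crux item stmt-BirchSwinnertonDyer-26074,
stub `stub_cmLambdaLower` = route decl `ResidualSignedLambdaLowerCMAtTwo`, stmt-22608).

§A (PROVED, pure algebra over Mathlib):
* `det_sub_one_fin_two`, `trace_mul_self_fin_two`, `trace_pow_two_pow_of_two_eq_zero` — for a `2 × 2`
  matrix, `det (N − 1) = det N − tr N + 1`, `tr (N²) = (tr N)² − 2 det N`, hence in characteristic `2`
  `tr (M ^ 2^r) = (tr M) ^ 2^r`;
* `eq_zero_of_mulVec_eq_self`, `eq_zero_of_pow_two_pow_mulVec_eq_self` — ODD-TRACE RIGIDITY: over a field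
  with `2 = 0`, a `2 × 2` matrix of determinant `1` and NON-ZERO trace has no non-zero fixed vector, and
  neither has any `M ^ 2^r`.  This is the linear algebra that makes the Greenberg–Vatsal / UTD fixed-point
  count `#H¹(ℚ_{∞,η}, A_ρ[2^k]) = #{b : φ^{2^R} b = ℓ^{2^R} b}` equal to `1` at a good place with
  `‖a_ℓ(g)‖ = 1`, i.e. the local block `D_w = H¹(ℚ_{∞,η}, A_ρ)` VANISHES there (card §2, Plan A);
* `sum_bracket_eq_sum_filter` — the crux's exponent `Σ_{v∈S₀} 2^{n_v}·d_{g,v}` lives on the CONTRIBUTING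
  places `S₀♯ = {v ∈ S₀ : ℓ_v ∤ M, ‖a_{ℓ_v}(g)‖ < 1}` and equals `Σ_{S₀♯} 2^{n_v}·2` as soon as the level-prime
  bracket vanishes (`d_{g,v} ∈ {0, 2}`: there are no `d = 1` places);
* `isOneCocycle_charSmul`, `charSmul_eq_zero_of_coboundary` — the tame Kummer section `m ↦ (h ↦ t(h)•m)` is
  a cocycle on invariants and a coboundary only if `t(h)•m = 0` on the kernel of the action (card Plan B).

§B (SIGNATURES ONLY, as `Prop`s — nothing asserted, no `sorry`): `LocalVanishingAtOddTracePlace` (the new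
structural target) and `LocalBlockDichotomyCount` (H3 of k2-g8 and the vanishing in ONE count statement),
typed over the tree's UTD / `GreenbergSelmer` vocabulary exactly as in `Sketch_sidea_k2_g8.lean` §B.

BSD is NOT proved by any of this; nothing here is a tree proposal.
-/

set_option autoImplicit false
set_option linter.dupNamespace false

noncomputable section

open scoped Classical

namespace Summit.BirchSwinnertonDyer.BirchSwinnertonDyer.Cruxes.ResidualThetaCountLowerPureAtTwo.SideaK1G11

/-! ## §A · proved algebra -/

section LinearAlgebra

variable {R : Type*} [CommRing R]

/-- `det (N − 1) = det N − tr N + 1` for a `2 × 2` matrix. -/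
theorem det_sub_one_fin_two (N : Matrix (Fin 2) (Fin 2) R) :
    (N - 1).det = N.det - N.trace + 1 := by
  have h01 : (1 : Matrix (Fin 2) (Fin 2) R) 0 1 = 0 := Matrix.one_apply_ne (by decide)
  have h10 : (1 : Matrix (Fin 2) (Fin 2) R) 1 0 = 0 := Matrix.one_apply_ne (by decide)
  have h00 : (1 : Matrix (Fin 2) (Fin 2) R) 0 0 = 1 := Matrix.one_apply_eq 0
  have h11 : (1 : Matrix (Fin 2) (Fin 2) R) 1 1 = 1 := Matrix.one_apply_eq 1
  simp only [Matrix.det_fin_two, Matrix.trace_fin_two, Matrix.sub_apply, h01, h10, h00, h11]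
  ring

/-- `tr (N·N) = (tr N)² − 2·det N` for a `2 × 2` matrix. -/
theorem trace_mul_self_fin_two (N : Matrix (Fin 2) (Fin 2) R) :
    (N * N).trace = N.trace ^ 2 - 2 * N.det := by
  simp only [Matrix.trace_fin_two, Matrix.det_fin_two, Matrix.mul_apply, Fin.sum_univ_two]
  ring

/-- In characteristic `2`: `tr (M ^ 2^r) = (tr M) ^ 2^r` for a `2 × 2` matrix (any determinant). -/
theorem trace_pow_two_pow_of_two_eq_zero (h2 : (2 : R) = 0) (M : Matrix (Fin 2) (Fin 2) R) (r : ℕ) :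
    (M ^ 2 ^ r).trace = M.trace ^ 2 ^ r := by
  induction r with
  | zero => simp
  | succ r ih =>
    have e1 : M ^ 2 ^ (r + 1) = M ^ 2 ^ r * M ^ 2 ^ r := by
      rw [pow_succ, pow_mul, pow_two]
    rw [e1, trace_mul_self_fin_two, h2, zero_mul, sub_zero, ih, ← pow_mul, ← pow_succ]

/-- `det (M ^ 2^r − 1) = (tr M) ^ 2^r` in characteristic `2` when `det M = 1`: the matrix `M ^ 2^r − 1`
is invertible as soon as `tr M` is a unit (ODD TRACE). -/
theorem det_pow_two_pow_sub_one (h2 : (2 : R) = 0) (M : Matrix (Fin 2) (Fin 2) R) (hdet : M.det = 1)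
    (r : ℕ) : (M ^ 2 ^ r - 1).det = M.trace ^ 2 ^ r := by
  rw [det_sub_one_fin_two, Matrix.det_pow, hdet, one_pow, trace_pow_two_pow_of_two_eq_zero h2]
  linear_combination (1 - M.trace ^ 2 ^ r) * h2

variable {k : Type*} [Field k]

/-- ODD-TRACE RIGIDITY (one matrix): over a field with `2 = 0`, a `2 × 2` matrix with `det = 1` and
`trace ≠ 0` has no non-zero fixed vector. -/
theorem eq_zero_of_mulVec_eq_self (h2 : (2 : k) = 0) (N : Matrix (Fin 2) (Fin 2) k) (hdet : N.det = 1)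
    (htr : N.trace ≠ 0) (v : Fin 2 → k) (hv : ∀ i, ∑ j, N i j * v j = v i) : v = 0 := by
  have e0 := hv 0
  have e1 := hv 1
  simp only [Fin.sum_univ_two] at e0 e1
  rw [Matrix.det_fin_two] at hdet
  have hx : N.trace * v 0 = 0 := by
    rw [Matrix.trace_fin_two]
    linear_combination (1 - N 1 1) * e0 + N 0 1 * e1 + v 0 * hdet + v 0 * h2
  have hy : N.trace * v 1 = 0 := by
    rw [Matrix.trace_fin_two]
    linear_combination N 1 0 * e0 + (1 - N 0 0) * e1 + v 1 * hdet + v 1 * h2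
  funext i
  fin_cases i
  · simpa [htr] using hx
  · simpa [htr] using hy

/-- ODD-TRACE RIGIDITY (all `2`-power iterates): with `2 = 0`, `det M = 1`, `trace M ≠ 0`, no iterate
`M ^ 2^r` has a non-zero fixed vector.  Feeds the UTD count
`exists_forall_natCard_subgroupH1_localSubgroup_eq` (`#H¹ = #{b : φ^{2^R} b = ℓ^{2^R} b}`) at a good
place of ODD trace: the count is `1`. -/
theorem eq_zero_of_pow_two_pow_mulVec_eq_self (h2 : (2 : k) = 0) (M : Matrix (Fin 2) (Fin 2) k)
    (hdet : M.det = 1) (htr : M.trace ≠ 0) (r : ℕ) (v : Fin 2 → k)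
    (hv : ∀ i, ∑ j, (M ^ 2 ^ r) i j * v j = v i) : v = 0 := by
  refine eq_zero_of_mulVec_eq_self h2 (M ^ 2 ^ r) ?_ ?_ v hv
  · rw [Matrix.det_pow, hdet, one_pow]
  · rw [trace_pow_two_pow_of_two_eq_zero h2]
    exact pow_ne_zero _ htr

end LinearAlgebra

section Exponent

/-- The crux's exponent lives on the CONTRIBUTING places: if the level-prime bracket never fires
(`P v → ¬ Q v`, i.e. `ℓ ∣ M → ¬ ‖a_ℓ(g) − 1‖ < 1`), then
`Σ_{v∈S} c_v · (if P v then [Q v] else 2·[R v]) = Σ_{v ∈ S, ¬P v ∧ R v} 2·c_v` — there are no `d = 1`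
places and the sum is over `S♯ = {¬P ∧ R}` only. -/
theorem sum_bracket_eq_sum_filter {ι : Type*} (S : Finset ι) (c : ι → ℕ) (P Q R' : ι → Prop)
    [DecidablePred P] [DecidablePred Q] [DecidablePred R']
    (hPQ : ∀ v ∈ S, P v → ¬ Q v) :
    ∑ v ∈ S, c v * (if P v then (if Q v then 1 else 0) else (if R' v then 2 else 0)) =
      ∑ v ∈ S.filter (fun v => ¬ P v ∧ R' v), c v * 2 := by
  rw [Finset.sum_filter]
  refine Finset.sum_congr rfl fun v hv => ?_
  by_cases hP : P v
  · have hQ : ¬ Q v := hPQ v hv hP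
    simp [hP, hQ]
  · by_cases hR : R' v
    · simp [hP, hR]
    · simp [hP, hR]

end Exponent

section KummerSection

variable {H : Type*} [Group H] {A : Type*} [AddCommGroup A] [DistribMulAction H A]

/-- The tame Kummer section on invariants is a `1`-cocycle: for an additive character `t : H → ℤ` and an
`H`-INVARIANT `m`, `h ↦ t(h) • m` satisfies the cocycle identity. -/
theorem isOneCocycle_charSmul (t : H → ℤ) (ht : ∀ g h, t (g * h) = t g + t h) (m : A)
    (hm : ∀ h : H, h • m = m) (g h : H) :
    t (g * h) • m = t g • m + g • (t h • m) := by
  rw [ht, add_zsmul]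
  congr 1
  have e := map_zsmul (DistribSMul.toAddMonoidHom A g) (t h) m
  simp only [DistribSMul.toAddMonoidHom_apply] at e
  rw [e, hm]

/-- … and it is a coboundary only if `t(h) • m = 0` for every `h` acting trivially (the kernel `K_w` of the
action): injectivity of the Kummer section modulo `A[t(K_w)]`. -/
theorem charSmul_eq_zero_of_coboundary (t : H → ℤ) (m b : A) (hcob : ∀ h : H, t h • m = h • b - b)
    (h : H) (hh : ∀ a : A, h • a = a) : t h • m = 0 := by
  rw [hcob h, hh b, sub_self]

end KummerSection

/-! ## §B · typed signatures (Props only; nothing asserted) -/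

section Signatures

open Literature.NumberTheory.EllipticCurves Literature.NumberTheory.EllipticCurves.GreenbergSelmer
open Literature.NumberTheory.GaloisRepresentations NumberField IsDedekindDomain Field
open Rat.HeightOneSpectrum
open Summit.BirchSwinnertonDyer.Rank1Residual.X11b.Coinv (kerD)

/-- **(T0) VANISHING at a good ODD-trace place (signature).** For the cyclotomic `ℤ₂`-extension `κ` of `ℚ`,
`ρ : Γ_ℚ → GL₂(𝒪)` unramified at `v ∤ 2` with Frobenius characteristic polynomial `X² − aX + ℓ` and
`‖a‖ = 1` (odd trace: `¬ ‖a‖ < 1`, the crux's bracket `0`): the local block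
`D_w = H¹(Gal(ℚ̄_ℓ/ℚ_{∞,η}), A_ρ)` is ZERO.  Route: UTD `exists_forall_natCard_subgroupH1_localSubgroup_eq`
on `B := A_ρ[2^k]` gives `#H¹(H_η, A_ρ[2^k]) = #ker(M^{2^R} − ℓ^{2^R})`, which is `1` by
`det_pow_two_pow_sub_one` / `eq_zero_of_pow_two_pow_mulVec_eq_self` (the determinant is a unit of `𝒪`);
Kummer `H¹(H_η, A[2^k]) ↠ H¹(H_η, A)[2^k]` and `2`-primarity (`exists_pow_nsmul_eq_zero_one`) finish. -/
def LocalVanishingAtOddTracePlace : Prop :=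
  ∀ (S : Set (PadicAlgCl 2)) [FiniteDimensional ℚ_[2] ↥(padicCoeffField S)]
    (κ : ZpExtension ℚ 2), κ.IsCyclotomic →
  ∀ (ρ : FramedGaloisRep ℚ ↥(padicCoeffIntegers S) 2) (v : HeightOneSpectrum (𝓞 ℚ)),
    ((2 : ℕ) : 𝓞 ℚ) ∉ v.asIdeal → ρ.IsUnramifiedAt v →
    (∃ (a : PadicAlgCl 2) (P : Polynomial ↥(padicCoeffIntegers S)), ¬ ‖a‖ < 1 ∧
        P.map (padicCoeffIntegers S).subtype =
          Polynomial.X ^ 2 - Polynomial.C a * Polynomial.X + Polynomial.C ((natGenerator v : ℕ) : PadicAlgCl 2) ∧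
        ρ.HasFrobCharpolyAt v P) →
    ∀ y : subgroupH1 (kerD κ v) (Cofree ρ ↥(padicCoeffField S)), y = 0

/-- **DICHOTOMY COUNT at a good place `v ∤ 2M` (signature).** Same binders with the charpoly `X² − aX + ℓ`
and an irreducible `ϖ`: for every `m`,
`#H¹(ℚ_{∞,η}, A_ρ)[ϖ^m] = if ‖a‖ < 1 then (#𝒪/ϖ)^{2m} else 1` — the block is the COEFFICIENT MODULE
(corank `2 = d_{g,ℓ}`, k2-g8 H2/H3: `kerD κ v` acts trivially, tame evaluation `H¹ = Hom_cont(ℤ₂, A_ρ) = A_ρ`)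
or ZERO (T0).  There is no third case (`d_{g,ℓ} = 1` needs `2 ∤ ℓ − 1`, impossible for odd `ℓ`). -/
def LocalBlockDichotomyCount : Prop :=
  ∀ (S : Set (PadicAlgCl 2)) [FiniteDimensional ℚ_[2] ↥(padicCoeffField S)]
    (κ : ZpExtension ℚ 2), κ.IsCyclotomic →
  ∀ (ρ : FramedGaloisRep ℚ ↥(padicCoeffIntegers S) 2) (v : HeightOneSpectrum (𝓞 ℚ)),
    ((2 : ℕ) : 𝓞 ℚ) ∉ v.asIdeal → ρ.IsUnramifiedAt v →
    ∀ (a : PadicAlgCl 2) (P : Polynomial ↥(padicCoeffIntegers S)),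
        P.map (padicCoeffIntegers S).subtype =
          Polynomial.X ^ 2 - Polynomial.C a * Polynomial.X + Polynomial.C ((natGenerator v : ℕ) : PadicAlgCl 2) →
        ρ.HasFrobCharpolyAt v P →
    ∀ (ϖ : ↥(padicCoeffIntegers S)), Irreducible ϖ → ∀ m : ℕ,
      Nat.card {y : subgroupH1 (kerD κ v) (Cofree ρ ↥(padicCoeffField S)) //
          scalarH1 (kerD κ v) (Cofree ρ ↥(padicCoeffField S)) (ϖ ^ m) y = 0} =
        if ‖a‖ < 1 then Nat.card (↥(padicCoeffIntegers S) ⧸ Ideal.span {ϖ}) ^ (2 * m) else 1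

end Signatures

end Summit.BirchSwinnertonDyer.BirchSwinnertonDyer.Cruxes.ResidualThetaCountLowerPureAtTwo.SideaK1G11

end
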